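/-
Width seat `ym-line-cbag-p1-w3` (prover-ym-line-cbag-p1-w3-g8-0; own items stmt-QuantumFields-22254 `BoxFloorAllGroups` /
stmt-QuantumFields-22893 `ExpChartPackage2` CLOSED proved), helping LINE 3 `route-QuantumFields-SixPlaneColdBox`
(crux stmt-QuantumFields-25709 `DensityTransferG`): the deterministic core of the one-scale kernel-COVARIANCE expansion with datum for an
ARBITRARY pair of plaquettes touching the cold box (all 36 plane pairs of the six-plane density, temporal planes included).
-/
import Summits.QuantumFields.YangMills.Theorems.ColdBoxAllGroupsBulkAllGroupsKernelCovDatumCoreG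
import Summits.QuantumFields.YangMills.Theorems.WeakCouplingRatesColdBoxGaussMoments

/-!
# LINE 3 `SixPlaneColdBox`, glue «KernelCovPairsG», part 1: the kernel covariance with a crude-good datum at fixed `β`, ANY PLAQUETTE PAIR

Crux `DensityTransferG` (stmt-QuantumFields-25709) runs the engine of `BulkAllGroups` «for all 36 plane pairs incl. temporal planes» (planner's
foreseen split (a): «kernel covariance/mean expansions with datum for temporal and cross pairs — the engine's `…KernelCovDatum*G`,
`…KernelMeanDatum*G` verbatim for other planes»).  The tree's datum covariance core `abs_kernelCovG_sub_gaussian_le_datum` (lead p2,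
`ColdBoxAllGroupsBulkAllGroupsKernelCovDatumCoreG`) is typed for the centre pair `(c_H; 1,2)`, `(c_H + Te₀; 1,2)` only, although every brick it
assembles is pair-generic: the representation T3' `integral_cond_boxKernelG_eq_integral_tilted_datum'` (any gauge-invariant observable), the
on-`S` bound `beta_mul_plaqCostAt_mem_Icc_of_mem_goodTDE` (any plaquette touching the box), the surrogate's form `qObsDE_eq_half_sum_sq` (any
plaquette), the abstract `D`-colour core with moments `abs_kernelCovG_sub_gaussian_le_moments` (any sites and planes), the Dirichlet variances
`integral_dirCirc_sq_le_one_of_touching` (any plaquette touching the box) and `moment_consts_le`.  This file re-runs that proof for two ARBITRARY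
plaquettes `P₁, Q₁ ∈ plaquettesTouching (boxEdges 4 (2H+1))` (as the flat-datum BOX core was generalised in `ColdBoxAllGroupsBoxAllPairsCoreG`):

* **`abs_kernelCovG_sub_gaussian_le_datum_pair`** — `|β²·Cov_{γ(·|W)}(c_{P₁}, c_{Q₁}) − ((D/2)·C_D(P₁,Q₁)² + (Σ_c F'_c(P₁)F'_c(Q₁))·C_D(P₁,Q₁))|
  ≤ 6(2Nβ)²pY + 3M²(e^{2w}−1) + 6M²P + 2τ(M+K₁) + √P(2MK₁+K₂+K₁²)` with the same bookkeeping letters as the centre-pair core.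

Part 2 (`SixPlaneColdBoxKernelCovPairsSharpG`) discharges the window inputs at one `β` for any two near-centre plaquettes and the numeric
bookkeeping eventually in `β` at the sharp precision `β^{−1/5}`.  No sorry; no new definition; standard axioms.  NOT a claim about the Yang–Mills
mass gap: glue for a LINE onto the RECORD-type node `LatticeNonFreezing`; no summit statement is touched.
-/

set_option autoImplicit false

noncomputable section

open MeasureTheory ProbabilityTheory Finset Real Metric
open scoped ENNReal Matrix.Norms.Frobenius
open Literature.Probability.LatticeModels (Site)
open Literature.MathematicalPhysics.QuantumLattice
open Literature.MathematicalPhysics.QuantumFieldTheory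
open Literature.MathematicalPhysics.QuantumFieldTheory.LatticeMaxwell
open Literature.MathematicalPhysics.QuantumFieldTheory.AxialGauge
open Summit.QuantumFields.YangMills.Theorems.WeakCouplingRates
open Summit.QuantumFields.YangMills.Theorems.FreeEnergyLogCoefficient

namespace Summit.QuantumFields.YangMills.Theorems.ColdBoxAllGroups

variable {H : ℕ}

section Box

variable {N : ℕ} {G : Type} [Group G] (ρ : G →* Matrix (Fin N) (Fin N) ℂ)
variable [TopologicalSpace G] [IsTopologicalGroup G] [CompactSpace G] [MeasurableSpace G] [BorelSpace G] [SecondCountableTopology G]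

set_option maxHeartbeats 400000 in
/-- **The one-scale expansion of the kernel covariance with datum, assembled at fixed `β` (deterministic core), every compact group presented
in `U(N)`, for an ARBITRARY PAIR of plaquettes `P₁, Q₁` touching the cold box** — p2's `abs_kernelCovG_sub_gaussian_le_datum` verbatim with the
centre pair `(c_H; 1,2)`, `(c_H + Te₀; 1,2)` replaced by `(P₁, Q₁)`.  Hypotheses: the T3 inputs, three REAL inputs on the Gaussian window `S` (tilt
bound `w`, surrogate accuracy `τ` at the two plaquettes, bad mass `P`), the YM bad mass `pY`, and the background bound `R'` at the two plaquettes;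
conclusion `|β²·Cov_{γ(·|W)}(c_{P₁}, c_{Q₁}) − ((D/2)·C² + (Σ_c F'_c(P₁)F'_c(Q₁))·C)| ≤ 6(2Nβ)²pY + 3M²(e^{2w}−1) + 6M²P + 2τ(M+K₁) + √P(2MK₁+K₂+K₁²)`,
`C = boxDirProjKernel H P₁ Q₁`, `M = β^{2ε}`, `K₁ = 2D(R'²+2)`, `K₂ = 3D²(R'⁴+11)`. -/
theorem abs_kernelCovG_sub_gaussian_le_datum_pair (hρc : Continuous ρ) (hinj : Function.Injective ρ)
    (hρu : ∀ g, ρ g ∈ Matrix.unitaryGroup (Fin N) ℂ) {β ε r m w τ R' P pY : ℝ}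
    {P₁ Q₁ : ZdPlaquette 4} (hP₁ : P₁ ∈ plaquettesTouching (boxEdges 4 (2 * H + 1)))
    (hQ₁ : Q₁ ∈ plaquettesTouching (boxEdges 4 (2 * H + 1)))
    {g : EuclideanSpace ℝ (Fin (dimE ρ)) → ℝ} (hgm : Measurable g)
    (hβ : 1 ≤ β) (hH : 1 ≤ H) (hr : 0 ≤ r) (hm4 : m ≤ 1 / 4)
    {W : LGConfig 4 G} {ϑ : Fin (dimE ρ) → (Literature.MathematicalPhysics.QuantumLattice.ZdEdge 4 → ℝ)}
    (hW : ∀ e, e ∉ boxEdges 4 (2 * H + 1) → W e = expChart ρ (datVec ϑ e))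
    (hϑ : ∀ e, e ∉ boxEdges 4 (2 * H + 1) → ‖datVec ϑ e‖ ≤ r)
    (hball : ∀ u : G, ‖ρ u - 1‖ ≤ (12 * (H : ℝ) ^ 2 + 2 * H + 1) * (Real.sqrt 2 * Real.sqrt (β ^ (2 * ε - 1)) + 8 * r) →
      u ∈ expChart ρ '' closedBall (0 : EuclideanSpace ℝ (Fin (dimE ρ))) m)
    (hgpos : ∀ a, ‖a‖ ≤ m → 0 < g a) {c : ℝ≥0∞} (hc0 : c ≠ 0) (hctop : c ≠ ∞)
    (hdens : (chartMeasureE ρ (1 / 4)).restrict (closedBall 0 m) =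
      (c • (volume : Measure (EuclideanSpace ℝ (Fin (dimE ρ)))).restrict (closedBall 0 m)).withDensity
        (fun a => ENNReal.ofReal (g a)))
    (hpY : (boxKernelG ρ β H W).real (coldGoodSetG ρ H β ε)ᶜ ≤ pY) (hpY1 : pY < 1)
    (hP : (gaussD H (dimE ρ)).real
        (goodTDE ρ H β ε ϑ ∩ {t | ∀ e, ‖unscaleTE H (dimE ρ) β (t + meanTE H (dimE ρ) β ϑ) e‖ ≤ m})ᶜ ≤ P) (hP1 : P < 1)
    (hWb : ∀ t ∈ goodTDE ρ H β ε ϑ ∩ {t | ∀ e, ‖unscaleTE H (dimE ρ) β (t + meanTE H (dimE ρ) β ϑ) e‖ ≤ m},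
      |tiltWDE ρ H g β ϑ t| ≤ w)
    (hτ : 0 ≤ τ)
    (hSur₁ : ∀ t ∈ goodTDE ρ H β ε ϑ ∩ {t | ∀ e, ‖unscaleTE H (dimE ρ) β (t + meanTE H (dimE ρ) β ϑ) e‖ ≤ m},
      |qObsDE H (dimE ρ) β ϑ (P₁.1, P₁.2.1.1, P₁.2.1.2) t - β * plaqCostAt ρ P₁.1 P₁.2.1.1 P₁.2.1.2 (cfgTDE ρ H β ϑ t)| ≤ τ)
    (hSur₂ : ∀ t ∈ goodTDE ρ H β ε ϑ ∩ {t | ∀ e, ‖unscaleTE H (dimE ρ) β (t + meanTE H (dimE ρ) β ϑ) e‖ ≤ m},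
      |qObsDE H (dimE ρ) β ϑ (Q₁.1, Q₁.2.1.1, Q₁.2.1.2) t -
        β * plaqCostAt ρ Q₁.1 Q₁.2.1.1 Q₁.2.1.2 (cfgTDE ρ H β ϑ t)| ≤ τ)
    (hR'0 : 0 ≤ R')
    (hF₁ : ∀ c, |sCirc (glue (pin := fun e => e ∉ dirFreeEdges H) dirCorner (2 * H + 3) (sdatE β ϑ c)
        (mean (fun e => e ∉ dirFreeEdges H) dirCorner (2 * H + 3) (sdatE β ϑ c))) (P₁.1, P₁.2.1.1, P₁.2.1.2)| ≤ R')
    (hF₂ : ∀ c, |sCirc (glue (pin := fun e => e ∉ dirFreeEdges H) dirCorner (2 * H + 3) (sdatE β ϑ c)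
        (mean (fun e => e ∉ dirFreeEdges H) dirCorner (2 * H + 3) (sdatE β ϑ c))) (Q₁.1, Q₁.2.1.1, Q₁.2.1.2)| ≤ R') :
    |β ^ 2 * ((∫ U, plaqCostAt ρ P₁.1 P₁.2.1.1 P₁.2.1.2 U * plaqCostAt ρ Q₁.1 Q₁.2.1.1 Q₁.2.1.2 U ∂(boxKernelG ρ β H W)) -
          (∫ U, plaqCostAt ρ P₁.1 P₁.2.1.1 P₁.2.1.2 U ∂(boxKernelG ρ β H W)) *
            (∫ U, plaqCostAt ρ Q₁.1 Q₁.2.1.1 Q₁.2.1.2 U ∂(boxKernelG ρ β H W))) -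
        ((dimE ρ : ℝ) / 2 * boxDirProjKernel H (P₁.1, P₁.2.1.1, P₁.2.1.2) (Q₁.1, Q₁.2.1.1, Q₁.2.1.2) ^ 2 +
          (∑ c, sCirc (glue (pin := fun e => e ∉ dirFreeEdges H) dirCorner (2 * H + 3) (sdatE β ϑ c)
                (mean (fun e => e ∉ dirFreeEdges H) dirCorner (2 * H + 3) (sdatE β ϑ c))) (P₁.1, P₁.2.1.1, P₁.2.1.2) *
              sCirc (glue (pin := fun e => e ∉ dirFreeEdges H) dirCorner (2 * H + 3) (sdatE β ϑ c)
                (mean (fun e => e ∉ dirFreeEdges H) dirCorner (2 * H + 3) (sdatE β ϑ c))) (Q₁.1, Q₁.2.1.1, Q₁.2.1.2)) *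
            boxDirProjKernel H (P₁.1, P₁.2.1.1, P₁.2.1.2) (Q₁.1, Q₁.2.1.1, Q₁.2.1.2))| ≤
      6 * (2 * N * β) * (2 * N * β) * pY +
        (3 * (β ^ (2 * ε)) ^ 2 * (Real.exp (2 * w) - 1) + 6 * (β ^ (2 * ε)) ^ 2 * P +
          2 * τ * (β ^ (2 * ε) + 2 * (dimE ρ) * (R' ^ 2 + 2)) +
          Real.sqrt P * (2 * β ^ (2 * ε) * (2 * (dimE ρ) * (R' ^ 2 + 2)) + 3 * (dimE ρ : ℝ) ^ 2 * (R' ^ 4 + 11) +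
            (2 * (dimE ρ) * (R' ^ 2 + 2)) ^ 2)) := by
  have hβ0 : 0 < β := by linarith
  -- abbreviations
  set μ := boxKernelG ρ β H W with hμ
  set Gd := coldGoodSetG ρ H β ε with hGd
  set γ : Measure (TSpaceD H (dimE ρ)) := gaussD H (dimE ρ) with hγ
  set S : Set (TSpaceD H (dimE ρ)) := goodTDE ρ H β ε ϑ ∩
    {t | ∀ e, ‖unscaleTE H (dimE ρ) β (t + meanTE H (dimE ρ) β ϑ) e‖ ≤ m} with hS
  set x₁ : Site 4 := P₁.1 with hx₁
  set i₁ : Fin 4 := P₁.2.1.1 with hi₁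
  set j₁ : Fin 4 := P₁.2.1.2 with hj₁
  set x₂ : Site 4 := Q₁.1 with hx₂
  set i₂ : Fin 4 := Q₁.2.1.1 with hi₂
  set j₂ : Fin 4 := Q₁.2.1.2 with hj₂
  set Fb : Fin (dimE ρ) → ℝ := fun c => sCirc (glue (pin := fun e => e ∉ dirFreeEdges H) dirCorner (2 * H + 3) (sdatE β ϑ c)
      (mean (fun e => e ∉ dirFreeEdges H) dirCorner (2 * H + 3) (sdatE β ϑ c))) (x₁, i₁, j₁) with hFb
  set Gb : Fin (dimE ρ) → ℝ := fun c => sCirc (glue (pin := fun e => e ∉ dirFreeEdges H) dirCorner (2 * H + 3) (sdatE β ϑ c)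
      (mean (fun e => e ∉ dirFreeEdges H) dirCorner (2 * H + 3) (sdatE β ϑ c))) (x₂, i₂, j₂) with hGb
  set M : ℝ := β ^ (2 * ε) with hM
  have hM0 : 0 ≤ M := by positivity
  have hD0 : (0 : ℝ) ≤ (dimE ρ : ℝ) := Nat.cast_nonneg _
  -- measurability and the two charged events
  have hGm : MeasurableSet Gd := measurableSet_coldGoodSetG ρ hρc β ε
  have hSm : MeasurableSet S :=
    (measurableSet_goodTDE ρ hρc hinj β ε ϑ).inter (measurableSet_ball_unscaleTE_add (dimE ρ) β m _)
  haveI : IsProbabilityMeasure μ := isProbabilityMeasure_boxKernelG ρ hρc β H W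
  haveI : IsProbabilityMeasure γ := isProbabilityMeasure_gaussD H (dimE ρ)
  have hG0 : μ Gd ≠ 0 := measure_ne_zero_of_real_compl_lt_one μ hGm (hpY.trans_lt hpY1)
  have hS0 : γ S ≠ 0 := measure_ne_zero_of_real_compl_lt_one γ hSm (hP.trans_lt hP1)
  -- the three representation identities (T3')
  have hmeas : ∀ (x : Site 4) (i j : Fin 4), Measurable fun U : LGConfig 4 G => β * plaqCostAt ρ x i j U := fun x i j =>
    (measurable_plaqCostAt_of_continuous ρ hρc x i j).const_mul β
  have hnn : ∀ (x : Site 4) (i j : Fin 4) (U : LGConfig 4 G), 0 ≤ β * plaqCostAt ρ x i j U := fun x i j U => by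
    refine mul_nonneg hβ0.le ?_
    simp only [plaqCostAt, plaquetteObs]
    rw [Literature.MathematicalPhysics.QuantumFieldTheory.sub_re_trace_eq_half_norm_sub_one_sq (hρu _)]
    positivity
  have hrep : ∀ X : LGConfig 4 G → ℝ, Measurable X → IsZdGaugeInvariant X → (∀ U, 0 ≤ X U) →
      ∫ U, X U ∂(μ[|Gd]) = ∫ t, X (cfgTDE ρ H β ϑ t) ∂((γ[|S]).tilted (S.indicator (tiltWDE ρ H g β ϑ))) :=
    fun X hXm hXinv hX0 => integral_cond_boxKernelG_eq_integral_tilted_datum' ρ hρc hinj hρu hβ0 hH hr hm4 hball hW hϑ hgm hgpos hc0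
      hctop hdens hG0 hS0 hXm hXinv hX0
  have hrepF := hrep _ (hmeas x₁ i₁ j₁) (isZdGaugeInvariant_const_mul_plaqCostAtG ρ β x₁ i₁ j₁) (hnn x₁ i₁ j₁)
  have hrepG := hrep _ (hmeas x₂ i₂ j₂) (isZdGaugeInvariant_const_mul_plaqCostAtG ρ β x₂ i₂ j₂) (hnn x₂ i₂ j₂)
  have hrepFG := hrep _ ((hmeas x₁ i₁ j₁).mul (hmeas x₂ i₂ j₂)) (isZdGaugeInvariant_const_mul_plaqCostAt_mulG ρ β x₁ x₂ i₁ j₁ i₂ j₂)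
    (fun U => mul_nonneg (hnn x₁ i₁ j₁ U) (hnn x₂ i₂ j₂ U))
  -- the tilt bound (indicator form), the on-`S` bounds and the surrogates
  have hw0 : 0 ≤ w := by
    by_cases hne : S.Nonempty
    · obtain ⟨t, ht⟩ := hne; exact (abs_nonneg _).trans (hWb t ht)
    · exfalso; apply hS0; rw [Set.not_nonempty_iff_eq_empty.1 hne, measure_empty]
  have hWt : ∀ t, |S.indicator (tiltWDE ρ H g β ϑ) t| ≤ w := by
    intro t
    by_cases ht : t ∈ S
    · rw [Set.indicator_of_mem ht]; exact hWb t ht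
    · rw [Set.indicator_of_notMem ht, abs_zero]; exact hw0
  have hFS : ∀ t ∈ S, 0 ≤ β * plaqCostAt ρ x₁ i₁ j₁ (cfgTDE ρ H β ϑ t) ∧ β * plaqCostAt ρ x₁ i₁ j₁ (cfgTDE ρ H β ϑ t) ≤ M := fun t ht => by
    have h := beta_mul_plaqCostAt_mem_Icc_of_mem_goodTDE ρ hρu hβ0 ht.1 hP₁
    exact h
  have hGS : ∀ t ∈ S, 0 ≤ β * plaqCostAt ρ x₂ i₂ j₂ (cfgTDE ρ H β ϑ t) ∧ β * plaqCostAt ρ x₂ i₂ j₂ (cfgTDE ρ H β ϑ t) ≤ M := fun t ht => by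
    have h := beta_mul_plaqCostAt_mem_Icc_of_mem_goodTDE ρ hρu hβ0 ht.1 hQ₁
    exact h
  have hSurF : ∀ t ∈ S, |β * plaqCostAt ρ x₁ i₁ j₁ (cfgTDE ρ H β ϑ t) - 1 / 2 * ∑ c, (Fb c + dirCirc H (x₁, i₁, j₁) (t c)) ^ 2| ≤ τ := by
    intro t ht
    have h := hSur₁ t ht
    rw [qObsDE_eq_half_sum_sq, abs_sub_comm] at h
    exact h
  have hSurG : ∀ t ∈ S, |β * plaqCostAt ρ x₂ i₂ j₂ (cfgTDE ρ H β ϑ t) - 1 / 2 * ∑ c, (Gb c + dirCirc H (x₂, i₂, j₂) (t c)) ^ 2| ≤ τ := by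
    intro t ht
    have h := hSur₂ t ht
    rw [qObsDE_eq_half_sum_sq, abs_sub_comm] at h
    exact h
  -- the abstract `D`-colour core with the Gaussian moments discharged
  have hcore := abs_kernelCovG_sub_gaussian_le_moments ρ hρu hρc (H := H) (D := dimE ρ) (β := β) W x₁ x₂ i₁ j₁ i₂ j₂ hGm hG0 hpY hM0
    (cfgTDE ρ H β ϑ) (measurable_cfgTDE ρ hρc hinj β ϑ) hSm hS0 hP (measurable_tiltWDE ρ hρc hinj hgm β ϑ) hWt hrepF hrepG hrepFG
    Fb Gb (x₁, i₁, j₁) (x₂, i₂, j₂) hτ hFS hGS hSurF hSurG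
  -- the moment constants: `|F'_c|, |G'_c| ≤ R'`, `0 ≤ C(p,p) ≤ 1`
  have hv1 := integral_dirCirc_sq_le_one_of_touching (H := H) hP₁
  have hv2 := integral_dirCirc_sq_le_one_of_touching (H := H) hQ₁
  have hC1 : boxDirProjKernel H (x₁, i₁, j₁) (x₁, i₁, j₁) ≤ 1 := by rw [integral_dirCirc_sq] at hv1; exact hv1
  have hC2 : boxDirProjKernel H (x₂, i₂, j₂) (x₂, i₂, j₂) ≤ 1 := by rw [integral_dirCirc_sq] at hv2; exact hv2
  have hC1' : 0 ≤ boxDirProjKernel H (x₁, i₁, j₁) (x₁, i₁, j₁) := boxDirProjKernel_self_nonneg _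
  have hC2' : 0 ≤ boxDirProjKernel H (x₂, i₂, j₂) (x₂, i₂, j₂) := boxDirProjKernel_self_nonneg _
  obtain ⟨hKsq, hK, hK'⟩ := moment_consts_le (D := dimE ρ) hR'0 hF₁ hF₂ hC1' hC1 hC2' hC2
  set A : ℝ := 2 * (dimE ρ : ℝ) * ∑ c, (Fb c ^ 4 + 3 * boxDirProjKernel H (x₁, i₁, j₁) (x₁, i₁, j₁) ^ 2) +
    2 * (dimE ρ) * ∑ c, (Gb c ^ 4 + 3 * boxDirProjKernel H (x₂, i₂, j₂) (x₂, i₂, j₂) ^ 2) with hA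
  set B : ℝ := (8 * (dimE ρ : ℝ) ^ 3 * ∑ c, (Fb c ^ 8 + 105 * boxDirProjKernel H (x₁, i₁, j₁) (x₁, i₁, j₁) ^ 4) +
    8 * (dimE ρ : ℝ) ^ 3 * ∑ c, (Gb c ^ 8 + 105 * boxDirProjKernel H (x₂, i₂, j₂) (x₂, i₂, j₂) ^ 4)) / 2 with hB
  set K₁ : ℝ := 2 * (dimE ρ) * (R' ^ 2 + 2) with hK₁
  set K₂ : ℝ := 3 * (dimE ρ : ℝ) ^ 2 * (R' ^ 4 + 11) with hK₂
  have hsqP : 0 ≤ Real.sqrt P := Real.sqrt_nonneg _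
  have hsqA : 0 ≤ Real.sqrt A := Real.sqrt_nonneg _
  have h1 : 2 * τ * (M + Real.sqrt A) ≤ 2 * τ * (M + K₁) :=
    mul_le_mul_of_nonneg_left (add_le_add le_rfl hK) (mul_nonneg (by norm_num) hτ)
  have h2 : Real.sqrt P * (2 * M * Real.sqrt A + Real.sqrt B + A) ≤ Real.sqrt P * (2 * M * K₁ + K₂ + K₁ ^ 2) :=
    mul_le_mul_of_nonneg_left (add_le_add (add_le_add (mul_le_mul_of_nonneg_left hK (mul_nonneg (by norm_num) hM0)) hK') hKsq) hsqP
  have h6 : 6 * (2 * N * |β|) * (2 * N * |β|) * pY = 6 * (2 * N * β) * (2 * N * β) * pY := by rw [abs_of_pos hβ0]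
  rw [h6] at hcore
  refine hcore.trans ?_
  linarith

end Box

end Summit.QuantumFields.YangMills.Theorems.ColdBoxAllGroups

end
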